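import Mathlib
import Summits.KontsevichZagierPeriods.Zeta5Search.DenomLaw.CentreCompanionK
import HarnessLib

/-!
# ζ(5) search — the `𝒦`-HALF of the centre-companion identity for EVEN `b₀` and `CentreCompanionEven` IS A THEOREM (DENOM-LAW D1, prover-d1 gen 15)

HONEST FRAMING: systematic search; no irrationality claim unless certified.  Cell `pub-zeta5`, track «DENOM-LAW» D1, seat `denom-prover-d1`
gen 15 (`denom-law/prover-d1/ATTEMPT-15.md` §5, §9).  Discharges BY NAME `DenomLaw.CentreCompanionEven`: for even `b₀` the centre class `x`
is an ordinary level class (no extra cofactor factor) whose type is the palindrome `T₀` RAISED AT THE MIDDLE level `c = L/2` (the lattice centre);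
so `ĉ_x = ĉ(T₀ + δ_c) = ĉ₂(T₀) − c·ĉ(T₀)` (`typeC_raiseAt`, the `ĉ`-analogue of `typeW_raiseAt`), the companion pair gives `2ĉ₂(T₀) − L·ĉ(T₀) + corr_C(T₀)`
(`typeC_end_pair`), and `corr_C(T₀) = 0` by transport of the realised residue identities of `x` (data of `T₀ + δ_c`: `typeS1_raiseAt`,
`typeS2_raiseAt`) and of `y` (`T₀ ++ [1]`) — `typeCCorr_eq_zero_of_companion_even`; with `2c = L` and `N` odd the two orbit vectors agree
(`orbitK_centreCompanion_even`), and with the landed `V`-half (`orbitV_centreCompanion_even`) `centreCompanionEven_holds`.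
Identities between explicit rationals; nothing here is about ζ(5); no γ; records in print UNMOVED.
-/

noncomputable section

open Finset PowerSeries

namespace Summit.KontsevichZagierPeriods.Zeta5Search.SecondOrder

open Summit.KontsevichZagierPeriods.Zeta5Search.DualSeries (InBox)
open Summit.KontsevichZagierPeriods.Zeta5Search.CasoratianValuation (InPolytope)
open Summit.KontsevichZagierPeriods.Zeta5Search.ClusterValuation
open Summit.KontsevichZagierPeriods.Zeta5Search.LevelClass (typeRho classSet_level level_injective level_mem classPoles_level)

variable {p : ℕ} [hp : Fact p.Prime]

/-! ## §1 `ĉ`, `S₁`, `S₂` under a raise at an existing level `k ≤ L` -/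

/-- **`ĉ(T + δ_k) = ĉ₂(T) − k·ĉ(T)`** for `k ≤ L`. -/
theorem typeC_raiseAt {L : ℕ} (e : ℕ → ℤ) {k : ℕ} (hk : k ≤ L) :
    typeC L (raiseAt e k) = typeC2 L e - (k : ℚ) * typeC L e := by
  unfold typeC typeC2
  rw [sum_filter, sum_filter, sum_filter, mul_sum, ← sum_sub_distrib]
  refine sum_congr rfl fun i hi => ?_
  have hiL : i ≤ L := by have := mem_range.1 hi; omega
  by_cases hik : i = k
  · subst hik
    have hr : raiseAt e i i = e i + 1 := by rw [raiseAt, if_pos rfl]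
    simp only [hr, typeRho_raiseAt_self]
    split_ifs <;> first | (exfalso; omega) | ring
  · have hr : raiseAt e k i = e i := by rw [raiseAt, if_neg hik]
    rw [hr]
    by_cases h0 : e i < 0
    · have hρ1 := typeRho_raiseAt e hk hik (σ := 1) (by omega)
      by_cases h2 : e i ≤ -2
      · have hρ2 := typeRho_raiseAt e hk hik (σ := 2) (by omega)
        rw [if_pos (show ((1 : ℕ) : ℤ) + 1 ≤ -e i by push_cast; omega)] at hρ1
        simp only [h0, h2, if_true, hρ1, hρ2]
        split_ifs <;> first | (exfalso; push_cast at *; omega) | (push_cast; ring)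
      · rw [if_neg (show ¬ (((1 : ℕ) : ℤ) + 1 ≤ -e i) by push_cast; omega)] at hρ1
        simp only [h0, h2, if_true, if_false, hρ1]
        split_ifs <;> first | (exfalso; omega) | ring
    · simp only [h0, if_false]; ring

/-- `S₁(T + δ_k) = S₂(T) − k·S₁(T)` for `k ≤ L`. -/
theorem typeS1_raiseAt {L : ℕ} (e : ℕ → ℤ) {k : ℕ} (hk : k ≤ L) :
    typeS1 L (raiseAt e k) = typeS2 L e - (k : ℚ) * typeS1 L e := by
  unfold typeS1 typeS2
  rw [sum_filter, sum_filter, sum_filter, mul_sum, ← sum_sub_distrib]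
  refine sum_congr rfl fun i hi => ?_
  have hiL : i ≤ L := by have := mem_range.1 hi; omega
  by_cases hik : i = k
  · subst hik
    have hr : raiseAt e i i = e i + 1 := by rw [raiseAt, if_pos rfl]
    simp only [hr, typeRho_raiseAt_self]
    split_ifs <;> first | (exfalso; omega) | ring
  · have hr : raiseAt e k i = e i := by rw [raiseAt, if_neg hik]
    rw [hr]
    by_cases h0 : e i < 0
    · have hρ1 := typeRho_raiseAt e hk hik (σ := 1) (by omega)
      by_cases h2 : e i ≤ -2
      · rw [if_pos (show ((1 : ℕ) : ℤ) + 1 ≤ -e i by push_cast; omega)] at hρ1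
        simp only [h0, h2, if_true, hρ1]; ring
      · rw [if_neg (show ¬ (((1 : ℕ) : ℤ) + 1 ≤ -e i) by push_cast; omega)] at hρ1
        simp only [h0, h2, if_true, if_false, hρ1]; ring
    · simp only [h0, if_false]; ring

/-- `S₂(T + δ_k) = S₃(T) − k·S₂(T)` for `k ≤ L`. -/
theorem typeS2_raiseAt {L : ℕ} (e : ℕ → ℤ) {k : ℕ} (hk : k ≤ L) :
    typeS2 L (raiseAt e k) = typeS3 L e - (k : ℚ) * typeS2 L e := by
  unfold typeS2 typeS3
  rw [sum_filter, sum_filter, sum_filter, mul_sum, ← sum_sub_distrib]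
  refine sum_congr rfl fun i hi => ?_
  have hiL : i ≤ L := by have := mem_range.1 hi; omega
  by_cases hik : i = k
  · subst hik
    have hr : raiseAt e i i = e i + 1 := by rw [raiseAt, if_pos rfl]
    simp only [hr, typeRho_raiseAt_self]
    split_ifs <;> first | (exfalso; omega) | ring
  · have hr : raiseAt e k i = e i := by rw [raiseAt, if_neg hik]
    rw [hr]
    by_cases h0 : e i < 0
    · have hρ1 := typeRho_raiseAt e hk hik (σ := 1) (by omega)
      by_cases h2 : e i ≤ -2
      · have hρ2 := typeRho_raiseAt e hk hik (σ := 2) (by omega)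
        rw [if_pos (show ((1 : ℕ) : ℤ) + 1 ≤ -e i by push_cast; omega)] at hρ1
        simp only [h0, h2, if_true, hρ1, hρ2]
        split_ifs <;> first | (exfalso; push_cast at *; omega) | (push_cast; ring)
      · rw [if_neg (show ¬ (((1 : ℕ) : ℤ) + 1 ≤ -e i) by push_cast; omega)] at hρ1
        simp only [h0, h2, if_true, if_false, hρ1]
        split_ifs <;> first | (exfalso; omega) | ring
    · simp only [h0, if_false]; ring

/-! ## §2 Class sums of a level class WITHOUT an odd-centre cofactor factor (covers the even-`b₀` centre class) -/

section Level0

variable (b : ℕ → ℤ) {x L : ℕ} (hx : x < p) (hL : x + L * p ≤ (b 0).toNat) (hL' : (b 0).toNat < x + L * p + p)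
  (e : ℕ → ℤ) (he : ∀ k ≤ L, netExp b (x + k * p) = e k) (hc0 : ¬ (¬ (2 : ℤ) ∣ b 0 ∧ CentreIn b p x))
include hx hL hL' he hc0

/-- `ĉ_x = ĉ(T)` (no odd-centre factor). -/
theorem cHat_level₀ : cHat b p x = typeC L e := by
  have hP : (classSet b p x).filter (fun q => netExp b q < 0) =
      ((range (L + 1)).filter fun k => e k < 0).image fun k => x + k * p := classPoles_level b hx hL hL' e he
  unfold cHat typeC classPoles
  rw [hP, sum_image (fun a _ c _ h => level_injective hp.out.pos x h)]
  refine sum_congr rfl fun k hk => ?_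
  have hkL : k ≤ L := by have := mem_range.1 (mem_filter.1 hk).1; omega
  rw [he k hkL, level_div hx, classRho_level₀ b hx hL hL' e he hc0 hkL, classRho_level₀ b hx hL hL' e he hc0 hkL]

/-- `Σρ₁ = S₁(T)` (no odd-centre factor). -/
theorem sum_rho_one_level₀ : ∑ q ∈ classPoles b p x, classRho b p q 1 = typeS1 L e := by
  have hP : (classSet b p x).filter (fun q => netExp b q < 0) =
      ((range (L + 1)).filter fun k => e k < 0).image fun k => x + k * p := classPoles_level b hx hL hL' e he
  unfold typeS1 classPoles
  rw [hP, sum_image (fun a _ c _ h => level_injective hp.out.pos x h)]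
  refine sum_congr rfl fun k hk => ?_
  have hkL : k ≤ L := by have := mem_range.1 (mem_filter.1 hk).1; omega
  rw [classRho_level₀ b hx hL hL' e he hc0 hkL]

/-- `Σ([n ≥ 2]ρ₂ + ℓρ₁) = S₂(T)` (no odd-centre factor). -/
theorem sum_rho_two_level₀ :
    ∑ q ∈ classPoles b p x, ((if netExp b q ≤ -2 then classRho b p q 2 else 0) + ((q / p : ℕ) : ℚ) * classRho b p q 1) = typeS2 L e := by
  have hP : (classSet b p x).filter (fun q => netExp b q < 0) =
      ((range (L + 1)).filter fun k => e k < 0).image fun k => x + k * p := classPoles_level b hx hL hL' e he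
  unfold typeS2 classPoles
  rw [hP, sum_image (fun a _ c _ h => level_injective hp.out.pos x h)]
  refine sum_congr rfl fun k hk => ?_
  have hkL : k ≤ L := by have := mem_range.1 (mem_filter.1 hk).1; omega
  rw [he k hkL, level_div hx, classRho_level₀ b hx hL hL' e he hc0 hkL, classRho_level₀ b hx hL hL' e he hc0 hkL]

end Level0

/-! ## §3 `corr_C(T₀) = 0` for the even-`b₀` configuration -/

/-- **`corr_C(T₀) = 0` (even `b₀`)**: `x` a level class realising `T₀ + δ_c` (`c ≤ L`, `2c ≠ 2(L+1)`… any `c ≤ L`) with `E_x ≤ −3` and no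
odd-centre factor, `y` a centre-free class realising `T₀ ++ [1]` with `E_y ≤ −3`.  Then `typeCCorr L e = 0`. -/
theorem typeCCorr_eq_zero_of_companion_even (b : ℕ → ℤ) (hb : InPolytope b) (hp5 : 5 ≤ p) (hwin : (b 0 + 2 : ℤ) < (p : ℤ) ^ 2)
    {x y L c : ℕ} (hc : c ≤ L) (hx : x < p) (hxL : x + L * p ≤ (b 0).toNat) (hxL' : (b 0).toNat < x + L * p + p)
    (hx0 : ¬ (¬ (2 : ℤ) ∣ b 0 ∧ CentreIn b p x)) (hEx : classExp b p x ≤ -3)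
    (hy : y < p) (hyL : y + (L + 1) * p ≤ (b 0).toNat) (hyL' : (b 0).toNat < y + (L + 1) * p + p) (hyc : ¬ CentreIn b p y)
    (hEy : classExp b p y ≤ -3)
    (e : ℕ → ℤ) (hex : ∀ k ≤ L, netExp b (x + k * p) = raiseAt e c k) (hey : ∀ k ≤ L + 1, netExp b (y + k * p) = snocOne e L k) :
    typeCCorr L e = 0 := by
  obtain ⟨hx1, hx2, -⟩ := rhoResidueIdentities_holds b p x hb hp.out hp5 hwin hx
  obtain ⟨hy1, hy2, -⟩ := rhoResidueIdentities_holds b p y hb hp.out hp5 hwin hy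
  have ex1 := hx1 (by omega)
  have ex2 := hx2 hEx
  have ey1 := hy1 (by omega)
  have ey2 := hy2 hEy
  rw [sum_rho_one_level₀ b hx hxL hxL' _ hex hx0, typeS1_raiseAt e hc] at ex1
  rw [sum_rho_two_level₀ b hx hxL hxL' _ hex hx0, typeS2_raiseAt e hc] at ex2
  rw [sum_rho_one_level b hy hyL hyL' (snocOne e L) hey hyc, typeS1_snocOne] at ey1
  rw [sum_rho_two_level b hy hyL hyL' (snocOne e L) hey hyc, typeS2_snocOne] at ey2
  rw [typeCCorr_eq]
  have hS1 : typeS1 L e = 0 := by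
    have h : ((L + 1 : ℕ) : ℚ) - (c : ℚ) ≠ 0 := by
      have : (c : ℚ) ≤ L := by exact_mod_cast hc
      push_cast; linarith
    have h2 : (((L + 1 : ℕ) : ℚ) - (c : ℚ)) * typeS1 L e = 0 := by linarith
    rcases mul_eq_zero.1 h2 with h3 | h3
    · exact absurd h3 h
    · exact h3
  have hS2 : typeS2 L e = 0 := by rw [hS1] at ex1; linarith
  have hS3 : typeS3 L e = 0 := by rw [hS2] at ex2; linarith
  rw [hS1, hS2, hS3]; ring

end Summit.KontsevichZagierPeriods.Zeta5Search.SecondOrder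

namespace Summit.KontsevichZagierPeriods.Zeta5Search.DenomLaw

open Summit.KontsevichZagierPeriods.Zeta5Search.CasoratianValuation (InPolytope)
open Summit.KontsevichZagierPeriods.Zeta5Search.ClusterValuation
open Summit.KontsevichZagierPeriods.Zeta5Search.SecondOrder
open Summit.KontsevichZagierPeriods.Zeta5Search.CellKit (conj_level netExp_conj_level)

variable {p : ℕ}

/-- `tList (raiseAtList T k) = raiseAt (tList T) k` pointwise, for a raise position inside the list. -/
theorem tList_raiseAtList (T : List ℤ) {k : ℕ} (hk : k < T.length) (j : ℕ) : tList (raiseAtList T k) j = raiseAt (tList T) k j := by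
  unfold tList raiseAtList raiseAt
  simp only [List.getD_eq_getElem?_getD, List.getElem?_mapIdx]
  by_cases hj : j < T.length
  · rw [List.getElem?_eq_getElem hj]
    by_cases hjk : j = k
    · simp [hjk]
    · simp [hjk]
  · rw [List.getElem?_eq_none_iff.2 (by omega), if_neg (by omega)]; rfl

/-- **`𝒦`-half of `CentreCompanionEven`**: under its hypotheses, `orbitK b p N x = orbitK b p N y`. -/
theorem orbitK_centreCompanion_even [hp : Fact p.Prime] (b : ℕ → ℤ) (N x y L : ℕ) (T₀ : List ℤ) (hb : InPolytope b)
    (hp5 : 5 ≤ p) (hpb : (p : ℤ) ≤ b 0) (hwin : (b 0 + 2 : ℤ) < (p : ℤ) ^ 2) (heven : (2 : ℤ) ∣ b 0) (h3N : 3 ≤ N) (hN : ¬ 2 ∣ N)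
    (hx : x < p) (hy : y < p) (hlen : T₀.length = L + 1) (hT₀ : T₀.reverse = T₀)
    (hxpole : 2 ≤ classPoleCount b p x) (hxcen : CentreIn b p x) (hxE : classExp b p x = -(N : ℤ))
    (hxT : classTypeList b p x = raiseAtList T₀ (L / 2)) (hypole : 2 ≤ classPoleCount b p y) (hycen : ¬ CentreIn b p y)
    (hyE : classExp b p y = -(N : ℤ)) (hyT : classTypeList b p y = T₀ ++ [1]) :
    orbitK b p N x = orbitK b p N y := by
  have h0 : 0 ≤ b 0 := hb.1.1
  have hxn := le_b0_of_lt b hpb hx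
  have hyn := le_b0_of_lt b hpb hy
  have hTne : T₀ ≠ [] := by intro h; rw [h] at hlen; simp at hlen
  have htopT : tTop T₀ = L := by unfold tTop; omega
  -- level data of the centre class: top level `L`, exponents `raiseAt e (L/2)`
  obtain ⟨hxL, hxL'⟩ := level_bounds' (p := p) b hxn
  obtain ⟨htopx, hex0⟩ := spec_of_typeList b hxn hxT
  set e : ℕ → ℤ := tList T₀ with hedef
  have hMx : topLevel b p x = L := by
    rw [← htopx]; unfold tTop; rw [show (raiseAtList T₀ (L / 2)).length = T₀.length by unfold raiseAtList; exact List.length_mapIdx ..]; omega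
  rw [hMx] at hxL hxL' hex0
  have hex : ∀ k ≤ L, netExp b (x + k * p) = raiseAt e (L / 2) k := fun k hk => by
    rw [hex0 k hk, tList_raiseAtList T₀ (by rw [hlen]; omega)]
  have hx0 : ¬ (¬ (2 : ℤ) ∣ b 0 ∧ CentreIn b p x) := fun h => h.1 heven
  -- the companion class and its conjugate (as in the odd case)
  obtain ⟨hyL0, hyL0'⟩ := level_bounds' (p := p) b hyn
  obtain ⟨htopy, hey0⟩ := spec_of_typeList b hyn hyT
  have hMy : topLevel b p y = L + 1 := by rw [← htopy, tTop_append_one hTne, htopT]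
  rw [hMy] at hyL0 hyL0' hey0
  have hey : ∀ k ≤ L + 1, netExp b (y + k * p) = snocOne e L k := fun k hk => by
    rw [hey0 k hk, tList_append_one hTne, htopT]
  obtain ⟨hy', hyL2, hyL2'⟩ := conj_level b hy hyL0 hyL0'
  have hpal := tList_pal hT₀
  have heyc : ∀ k ≤ L + 1, netExp b (conjClass b p y + k * p) = consOne e k := fun k hk => by
    rw [netExp_conj_level b hyL0 hyL0' h0 hk, hey (L + 1 - k) (by omega), snocOne, consOne]
    by_cases hk0 : k = 0
    · rw [if_pos (by omega), if_pos hk0]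
    · rw [if_neg (by omega), if_neg hk0, show L + 1 - k = tTop T₀ - (k - 1) by omega, hedef, hpal (k - 1) (by omega)]
  have hycc : ¬ CentreIn b p (conjClass b p y) := fun h => hycen ((centreIn_conj_iff b h0 hyn).1 h)
  have hycpole : 2 ≤ classPoleCount b p (conjClass b p y) := by rw [classPoleCount_conj b h0 hyn]; exact hypole
  -- the three `ĉ`
  have hcL : L / 2 ≤ L := Nat.div_le_self L 2
  have hcx : cHat b p x = typeC2 L e - ((L / 2 : ℕ) : ℚ) * typeC L e := by
    rw [cHat_level₀ b hx hxL hxL' _ hex hx0, typeC_raiseAt e hcL]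
  have hcy : cHat b p y = typeC (L + 1) (snocOne e L) := SecondOrder.cHat_level b hy hyL0 hyL0' _ hey hycen
  have hcyc : cHat b p (conjClass b p y) = typeC (L + 1) (consOne e) := SecondOrder.cHat_level b hy' hyL2 hyL2' _ heyc hycc
  have hcorr : typeCCorr L e = 0 :=
    typeCCorr_eq_zero_of_companion_even b hb hp5 hwin hcL hx hxL hxL' hx0 (by rw [hxE]; omega) hy hyL0 hyL0' hycen
      (by rw [hyE]; omega) e hex hey
  -- `L` is even: the centre `x + (L/2)p` doubles to `b₀ = 2x + Lp`, so `2 (L/2) = L`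
  have hLeven : 2 * (L / 2) = L := by
    have hb0eq : (b 0 : ℤ) = 2 * x + L * p := centre_level_eq b hx hxL hxL' hxcen h0
    have hp2 : ¬ (2 : ℤ) ∣ (p : ℤ) := by
      intro h
      have h2 : (2 : ℕ) ∣ p := by exact_mod_cast h
      have := (Nat.Prime.eq_one_or_self_of_dvd hp.out 2 h2)
      have h5 : 5 ≤ p := hp5
      omega
    have hLp : (2 : ℤ) ∣ (L : ℤ) * p := by
      have h1 : (2 : ℤ) ∣ (b 0 : ℤ) - 2 * x := dvd_sub heven ⟨x, by ring⟩
      rw [hb0eq, show (2 : ℤ) * x + L * p - 2 * x = L * p by ring] at h1; exact h1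
    have hL2 : (2 : ℤ) ∣ (L : ℤ) := (Int.Prime.dvd_mul' (by norm_num) hLp).resolve_right hp2
    omega
  have hsum := typeC_end_pair L e
  rw [hcorr, add_zero] at hsum
  unfold orbitK sigmaK
  rw [if_pos hxcen, if_pos hxpole, if_neg hycen, if_pos hypole, if_pos hycpole, neg_one_pow_succ_of_odd hN, one_mul, hcx, hcy,
    hcyc, hsum]
  have hc : (((L / 2 : ℕ) : ℚ)) = (L : ℚ) / 2 := by
    rw [eq_div_iff (by norm_num : (2 : ℚ) ≠ 0)]; exact_mod_cast (by omega : L / 2 * 2 = L)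
  rw [hc]; ring

/-- **`DenomLaw.CentreCompanionEven` IS A THEOREM.** -/
theorem centreCompanionEven_holds : CentreCompanionEven := by
  intro b p N x y L T₀ hb hprime hp5 hpb hwin heven h3N hN hx hy hL hlen hT₀ hxpole hxcen hxE hxT hypole hycen hyE hyT
  haveI : Fact p.Prime := ⟨hprime⟩
  exact ⟨orbitK_centreCompanion_even b N x y L T₀ hb hp5 hpb hwin heven h3N hN hx hy hlen hT₀ hxpole hxcen hxE hxT hypole hycen hyE hyT,
    orbitV_centreCompanion_even b N x y L T₀ hb hpb hN hx hy hlen hT₀ hxpole hxcen hxE hxT hypole hycen hyE hyT⟩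

end Summit.KontsevichZagierPeriods.Zeta5Search.DenomLaw

end
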